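import Literature.Analysis.Complex.RungeBoxes
import Mathlib.Analysis.Normed.Ring.Units
import HarnessLib

/-!
# Continuous cocycles on `ℂⁿ` are continuously trivial (topological triviality of bundles over `ℂⁿ`)

The topological counterpart of `Literature/Analysis/Complex/HolomorphicCocyclesAffine.lean`
(Grauert's theorem over `ℂⁿ`): let `{U_a}` be an open cover of `ℂ^ι` (`ι` finite) and
`g_{ab} : U_a ∩ U_b → 𝔄ˣ` a **continuous** multiplicative `1`-cocycle with values in the units of
a complete normed ring `𝔄` (`r × r` matrices: a topological complex vector bundle of rank `r` given by
transition matrices). Then the cocycle is **continuously trivial**: there are continuous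
`F_a : U_a → 𝔄ˣ` with `F_a = g_{ab} F_b` on `U_a ∩ U_b` (`ContCocycle.exists_cframe_univ`) —
"every (locally trivial) fibre bundle with structure group `𝔄ˣ` over `ℂⁿ ≅ ℝ^{2n}` is trivial", the
classical consequence of the contractibility of the base (N. Steenrod, *The Topology of Fibre
Bundles* (1951), §11.4 Cor. (bundles over cells are trivial) / §11.6). Together with Grauert's
theorem over `ℂⁿ` it gives the Oka–Grauert principle over `ℂⁿ` in the form of Leiterer, SCV IV,
Ch. II, Thm. 3.2 (ii): `c⁻¹ □ f = 1` is holomorphic for the continuous coboundary `f = c □ 1`.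

We give the elementary direct proof by the same cube induction as in the holomorphic case
(Leiterer, Ch. II, Lemma 5.2.1, structure of `HolCocycle.exists_frame_nhds_CBox`), in which
Cartan's lemma on holomorphic matrices is replaced by the trivial **continuous** attaching of frames
across a hyperplane `{y_d = t}`: if `F^A`, `F^B` are frames near `A = K ∩ {y_d ≤ t}`,
`B = K ∩ {y_d ≥ t}` with transition function `c = (F^A)⁻¹ F^B` near `A ∩ B`, then
`F = F^A` on `{y_d ≤ t}` and `F = F^B · (c ∘ π)⁻¹` on `{y_d ≥ t}` (`π` = the projection onto the
hyperplane) is a continuous frame near `K` (`exists_cframe_glue_step`). The exhaustion of `ℂ^ι` by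
cubes needs no approximation either: consecutive frames are made to AGREE on the smaller cube by the
correction `(c ∘ clampBox)⁻¹` (`nextCStage`), so the frames stabilise and define a global frame.

Everything is PROVED; cocycles and frames are data-carrying structures (`ContCocycle`,
`ContCocycle.CFrame`), no notion is posited.

## References

* N. Steenrod, *The Topology of Fibre Bundles*, Princeton (1951), §11.4–11.6 (bundles over
  contractible bases / cells are trivial) [folklore pointer].
* J. Leiterer, *Holomorphic vector bundles and the Oka–Grauert principle*, in: Several Complex
  Variables IV (1990), Ch. II, Lemma 5.2.1 and Thm. 3.2 (ii) [LeitererSCV4].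
-/

noncomputable section

open Complex Set Metric Filter Topology

namespace Literature.Analysis.Complex

/-! ### Continuous cocycles and continuous frames -/

section Defs

variable {ι : Type*} [Fintype ι] {𝔄 : Type*} [NormedRing 𝔄] {α : Type*}

/-- A **continuous multiplicative `1`-cocycle** on `ℂ^ι` with values in (the units of) the normed
ring `𝔄`: an open cover `U_a` (`a : α`) of `ℂ^ι` and continuous `g_{ab}` on `U_a ∩ U_b` with
`g_{aa} = 1` and `g_{ab} g_{bc} = g_{ac}` on triple overlaps (values off `U_a ∩ U_b` are junk) —
the transition cocycle of a topological `𝔄ˣ`-bundle (Leiterer: `f ∈ Z¹(𝒰, 𝒞^E)`, `E = X × GL(r)`).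
[cite: LeitererSCV4, Ch. II §1.7] -/
structure ContCocycle (ι : Type*) [Fintype ι] (𝔄 : Type*) [NormedRing 𝔄] (α : Type*) where
  /-- The open sets `U_a` of the cover. -/
  U : α → Set (ι → ℂ)
  /-- Each `U_a` is open. -/
  isOpen_U : ∀ a, IsOpen (U a)
  /-- The `U_a` cover `ℂ^ι`. -/
  exists_mem : ∀ z, ∃ a, z ∈ U a
  /-- The transition maps `g_{ab}`. -/
  g : α → α → (ι → ℂ) → 𝔄
  /-- `g_{ab}` is continuous on `U_a ∩ U_b`. -/
  continuousOn_g : ∀ a b, ContinuousOn (g a b) (U a ∩ U b)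
  /-- Normalisation `g_{aa} = 1`. -/
  g_self : ∀ a, ∀ z ∈ U a, g a a z = 1
  /-- The cocycle condition `g_{ab} g_{bc} = g_{ac}`. -/
  g_comp : ∀ a b c, ∀ z ∈ U a ∩ U b ∩ U c, g a b z * g b c z = g a c z

namespace ContCocycle

variable (𝓖 : ContCocycle ι 𝔄 α)

/-- `g_{ab} g_{ba} = 1`. [folklore] -/
theorem g_mul_g_symm {a b : α} {z : ι → ℂ} (ha : z ∈ 𝓖.U a) (hb : z ∈ 𝓖.U b) :
    𝓖.g a b z * 𝓖.g b a z = 1 := by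
  rw [𝓖.g_comp a b a z ⟨⟨ha, hb⟩, ha⟩, 𝓖.g_self a z ha]

/-- The transition maps have invertible values. [folklore] -/
theorem isUnit_g {a b : α} {z : ι → ℂ} (ha : z ∈ 𝓖.U a) (hb : z ∈ 𝓖.U b) : IsUnit (𝓖.g a b z) :=
  ⟨⟨𝓖.g a b z, 𝓖.g b a z, 𝓖.g_mul_g_symm ha hb, 𝓖.g_mul_g_symm hb ha⟩, rfl⟩

/-- A choice of a member of the cover containing `z`. [folklore] -/
def chart (z : ι → ℂ) : α :=
  Classical.choose (𝓖.exists_mem z)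

/-- `z ∈ U_{chart z}`. [folklore] -/
theorem mem_chart (z : ι → ℂ) : z ∈ 𝓖.U (𝓖.chart z) :=
  Classical.choose_spec (𝓖.exists_mem z)

/-- A **continuous frame** of the cocycle over the set `W`: continuous `F_a` with invertible values
on `W ∩ U_a` such that `F_a = g_{ab} F_b` on `W ∩ U_a ∩ U_b` — a topological trivialisation over
`W` (`g_{ab} = F_a F_b⁻¹`, Leiterer: `f = c □ 1`). [cite: LeitererSCV4, Ch. II §1.7] -/
structure CFrame (W : Set (ι → ℂ)) where
  /-- The frame maps `F_a`. -/
  F : α → (ι → ℂ) → 𝔄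
  /-- `F_a` is continuous on `W ∩ U_a`. -/
  continuousOn : ∀ a, ContinuousOn (F a) (W ∩ 𝓖.U a)
  /-- `F_a` has invertible values on `W ∩ U_a`. -/
  isUnit : ∀ a, ∀ z ∈ W ∩ 𝓖.U a, IsUnit (F a z)
  /-- `F_a = g_{ab} F_b` on `W ∩ U_a ∩ U_b`. -/
  transition : ∀ a b, ∀ z ∈ W ∩ 𝓖.U a ∩ 𝓖.U b, F a z = 𝓖.g a b z * F b z

namespace CFrame

variable {𝓖} {W W' W₁ W₂ : Set (ι → ℂ)}

/-- Restriction of a frame to a smaller set. [folklore] -/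
def restrict (Φ : 𝓖.CFrame W) (h : W' ⊆ W) : 𝓖.CFrame W' where
  F := Φ.F
  continuousOn a := (Φ.continuousOn a).mono (inter_subset_inter_left _ h)
  isUnit a z hz := Φ.isUnit a z ⟨h hz.1, hz.2⟩
  transition a b z hz := Φ.transition a b z ⟨⟨h hz.1.1, hz.1.2⟩, hz.2⟩

/-- The maps of a restricted frame (definitional). [folklore] -/
@[simp]
theorem restrict_F (Φ : 𝓖.CFrame W) (h : W' ⊆ W) : (Φ.restrict h).F = Φ.F :=
  rfl

variable (𝓖) in
/-- **The tautological frame over a member of the cover**: `F_b = g_{b a₀}` on `U_{a₀}`.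
[cite: LeitererSCV4, Ch. II §1.7] -/
def ofChart (a₀ : α) : 𝓖.CFrame (𝓖.U a₀) where
  F b := 𝓖.g b a₀
  continuousOn b := (𝓖.continuousOn_g b a₀).mono fun _ hz ↦ ⟨hz.2, hz.1⟩
  isUnit _ _ hz := 𝓖.isUnit_g hz.2 hz.1
  transition b c z hz := (𝓖.g_comp b c a₀ z ⟨⟨hz.1.2, hz.2⟩, hz.1.1⟩).symm

/-- **Right multiplication of a frame by an invertible continuous map** on `W` is again a frame.
[folklore] -/
def mulRight (Φ : 𝓖.CFrame W) (c : (ι → ℂ) → 𝔄) (hc : ContinuousOn c W)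
    (hu : ∀ z ∈ W, IsUnit (c z)) : 𝓖.CFrame W where
  F a z := Φ.F a z * c z
  continuousOn a := (Φ.continuousOn a).mul (hc.mono inter_subset_left)
  isUnit a z hz := (Φ.isUnit a z hz).mul (hu z hz.1)
  transition a b z hz := by rw [Φ.transition a b z hz, mul_assoc]

/-- The maps of a right-multiplied frame (definitional). [folklore] -/
@[simp]
theorem mulRight_F (Φ : 𝓖.CFrame W) (c : (ι → ℂ) → 𝔄) (hc : ContinuousOn c W)
    (hu : ∀ z ∈ W, IsUnit (c z)) (a : α) (z : ι → ℂ) : (Φ.mulRight c hc hu).F a z = Φ.F a z * c z :=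
  rfl

end CFrame

end ContCocycle

end Defs

/-! ### Inverses and transition functions between frames -/

section Step

variable {ι : Type*} [Fintype ι] {𝔄 : Type*} [NormedRing 𝔄] [CompleteSpace 𝔄] {α : Type*}

namespace ContCocycle

namespace CFrame

variable {𝓖 : ContCocycle ι 𝔄 α} {W W₁ W₂ : Set (ι → ℂ)}

/-- The pointwise inverse `F_a⁻¹` of a frame map. [folklore] -/
def inv (Φ : 𝓖.CFrame W) (a : α) (z : ι → ℂ) : 𝔄 :=
  Ring.inverse (Φ.F a z)

omit [CompleteSpace 𝔄] in
/-- `F_a F_a⁻¹ = 1` on `W ∩ U_a`. [folklore] -/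
theorem F_mul_inv (Φ : 𝓖.CFrame W) {a : α} {z : ι → ℂ} (hz : z ∈ W ∩ 𝓖.U a) :
    Φ.F a z * Φ.inv a z = 1 :=
  Ring.mul_inverse_cancel _ (Φ.isUnit a z hz)

omit [CompleteSpace 𝔄] in
/-- `F_a⁻¹ F_a = 1` on `W ∩ U_a`. [folklore] -/
theorem inv_mul_F (Φ : 𝓖.CFrame W) {a : α} {z : ι → ℂ} (hz : z ∈ W ∩ 𝓖.U a) :
    Φ.inv a z * Φ.F a z = 1 :=
  Ring.inverse_mul_cancel _ (Φ.isUnit a z hz)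

omit [CompleteSpace 𝔄] in
/-- The inverse of a frame map has invertible values. [folklore] -/
theorem isUnit_inv (Φ : 𝓖.CFrame W) {a : α} {z : ι → ℂ} (hz : z ∈ W ∩ 𝓖.U a) :
    IsUnit (Φ.inv a z) :=
  (Φ.isUnit a z hz).ringInverse

/-- `Ring.inverse` composed with a continuous invertible map is continuous. [folklore] -/
theorem _root_.Literature.Analysis.Complex.continuousOn_ringInverse_comp {X : Type*}
    [TopologicalSpace X] {f : X → 𝔄} {s : Set X} (hf : ContinuousOn f s)
    (hu : ∀ x ∈ s, IsUnit (f x)) : ContinuousOn (fun x ↦ Ring.inverse (f x)) s := by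
  intro x hx
  have h1 := NormedRing.inverse_continuousAt (hu x hx).unit
  rw [IsUnit.unit_spec] at h1
  exact h1.comp_continuousWithinAt (hf x hx)

/-- The inverse of a frame map is continuous on `W ∩ U_a`. [folklore] -/
theorem continuousOn_inv (Φ : 𝓖.CFrame W) (a : α) : ContinuousOn (Φ.inv a) (W ∩ 𝓖.U a) :=
  continuousOn_ringInverse_comp (Φ.continuousOn a) (Φ.isUnit a)

omit [CompleteSpace 𝔄] in
/-- The inverses transform by `F_b⁻¹ = F_a⁻¹ g_{ab}`. [folklore] -/
theorem inv_eq_inv_mul_g (Φ : 𝓖.CFrame W) {a b : α} {z : ι → ℂ}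
    (hz : z ∈ W ∩ 𝓖.U a ∩ 𝓖.U b) : Φ.inv b z = Φ.inv a z * 𝓖.g a b z := by
  have hb : z ∈ W ∩ 𝓖.U b := ⟨hz.1.1, hz.2⟩
  have ha : z ∈ W ∩ 𝓖.U a := hz.1
  have h1 : Φ.F b z * (Φ.inv a z * 𝓖.g a b z) = 1 := by
    rw [Φ.transition b a z ⟨⟨hz.1.1, hz.2⟩, hz.1.2⟩, mul_assoc, ← mul_assoc (Φ.F a z),
      Φ.F_mul_inv ha, one_mul, 𝓖.g_mul_g_symm hz.2 hz.1.2]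
  calc Φ.inv b z = Φ.inv b z * (Φ.F b z * (Φ.inv a z * 𝓖.g a b z)) := by rw [h1, mul_one]
    _ = Φ.inv a z * 𝓖.g a b z := by rw [← mul_assoc, Φ.inv_mul_F hb, one_mul]

/-- **The transition function between two frames** `Φ` on `W₁` and `Ψ` on `W₂`:
`c = F_a^{Φ,−1} F_a^{Ψ}`, independent of the member `a` of the cover (`transFun_eq`), a continuous
map with invertible values on `W₁ ∩ W₂` with `F^Ψ = F^Φ c`. [folklore] -/
def transFun (Φ : 𝓖.CFrame W₁) (Ψ : 𝓖.CFrame W₂) (z : ι → ℂ) : 𝔄 :=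
  Φ.inv (𝓖.chart z) z * Ψ.F (𝓖.chart z) z

omit [CompleteSpace 𝔄] in
/-- The transition function read in any member of the cover. [folklore] -/
theorem transFun_eq (Φ : 𝓖.CFrame W₁) (Ψ : 𝓖.CFrame W₂) {a : α} {z : ι → ℂ}
    (hz : z ∈ W₁ ∩ W₂ ∩ 𝓖.U a) : transFun Φ Ψ z = Φ.inv a z * Ψ.F a z := by
  set b := 𝓖.chart z
  have hb : z ∈ 𝓖.U b := 𝓖.mem_chart z
  unfold transFun
  rw [Φ.inv_eq_inv_mul_g (a := a) (b := b) ⟨⟨hz.1.1, hz.2⟩, hb⟩,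
    Ψ.transition b a z ⟨⟨hz.1.2, hb⟩, hz.2⟩, mul_assoc, ← mul_assoc (𝓖.g a b z),
    𝓖.g_mul_g_symm hz.2 hb, one_mul]

omit [CompleteSpace 𝔄] in
/-- `F^Ψ_a = F^Φ_a c` on `W₁ ∩ W₂ ∩ U_a`. [folklore] -/
theorem F_eq_F_mul_transFun (Φ : 𝓖.CFrame W₁) (Ψ : 𝓖.CFrame W₂) {a : α} {z : ι → ℂ}
    (hz : z ∈ W₁ ∩ W₂ ∩ 𝓖.U a) : Ψ.F a z = Φ.F a z * transFun Φ Ψ z := by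
  rw [transFun_eq Φ Ψ hz, ← mul_assoc, Φ.F_mul_inv ⟨hz.1.1, hz.2⟩, one_mul]

omit [CompleteSpace 𝔄] in
/-- The transition function has invertible values on `W₁ ∩ W₂`. [folklore] -/
theorem isUnit_transFun (Φ : 𝓖.CFrame W₁) (Ψ : 𝓖.CFrame W₂) {z : ι → ℂ} (hz : z ∈ W₁ ∩ W₂) :
    IsUnit (transFun Φ Ψ z) :=
  (Φ.isUnit_inv ⟨hz.1, 𝓖.mem_chart z⟩).mul (Ψ.isUnit _ z ⟨hz.2, 𝓖.mem_chart z⟩)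

/-- The transition function is continuous on `W₁ ∩ W₂` (open sets). [folklore] -/
theorem continuousOn_transFun (Φ : 𝓖.CFrame W₁) (Ψ : 𝓖.CFrame W₂) (h₁ : IsOpen W₁)
    (h₂ : IsOpen W₂) : ContinuousOn (transFun Φ Ψ) (W₁ ∩ W₂) := by
  intro z hz
  set a := 𝓖.chart z
  have ha : z ∈ 𝓖.U a := 𝓖.mem_chart z
  have hN : W₁ ∩ W₂ ∩ 𝓖.U a ∈ 𝓝 z := ((h₁.inter h₂).inter (𝓖.isOpen_U a)).mem_nhds ⟨hz, ha⟩
  have hev : transFun Φ Ψ =ᶠ[𝓝 z] fun w ↦ Φ.inv a w * Ψ.F a w :=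
    Filter.mem_of_superset hN fun w hw ↦ transFun_eq Φ Ψ hw
  have hc : ContinuousAt (fun w ↦ Φ.inv a w * Ψ.F a w) z := by
    refine ContinuousOn.continuousAt ?_ hN
    exact ((Φ.continuousOn_inv a).mono fun w hw ↦ ⟨hw.1.1, hw.2⟩).mul
      ((Ψ.continuousOn a).mono fun w hw ↦ ⟨hw.1.2, hw.2⟩)
  exact (hc.congr_of_eventuallyEq hev).continuousWithinAt

end CFrame

end ContCocycle

/-! ### Setting one real coordinate; the continuous attaching step -/

variable [DecidableEq ι]

/-- The point `z` with its real coordinate `d` set to `t` (projection onto the hyperplane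
`{y_d = t}` along the `d`-axis). [folklore] -/
def setCoord (d : ι × Bool) (t : ℝ) (z : ι → ℂ) : ι → ℂ :=
  Function.update z d.1 (if d.2 then (⟨t, (z d.1).im⟩ : ℂ) else ⟨(z d.1).re, t⟩)

omit [Fintype ι] in
/-- The coordinate `d` of `setCoord d t z` is `t`. [folklore] -/
theorem rc_setCoord_self (d : ι × Bool) (t : ℝ) (z : ι → ℂ) : rc d (setCoord d t z) = t := by
  obtain ⟨i, b⟩ := d
  cases b <;> simp [setCoord, rc]

omit [Fintype ι] in
/-- The other coordinates are unchanged. [folklore] -/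
theorem rc_setCoord_of_ne {d e : ι × Bool} (h : e ≠ d) (t : ℝ) (z : ι → ℂ) :
    rc e (setCoord d t z) = rc e z := by
  obtain ⟨i, b⟩ := d
  obtain ⟨j, b'⟩ := e
  by_cases hij : j = i
  · subst hij
    have hb : b' ≠ b := fun hb ↦ h (by rw [hb])
    cases b <;> cases b' <;> simp [setCoord, rc] at hb ⊢
  · cases b' <;> simp [setCoord, rc, Function.update_of_ne hij]

omit [Fintype ι] in
/-- `setCoord d t` is continuous. [folklore] -/
theorem continuous_setCoord (d : ι × Bool) (t : ℝ) : Continuous (setCoord d t) := by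
  obtain ⟨i, b⟩ := d
  unfold setCoord
  refine continuous_pi fun j ↦ ?_
  by_cases hj : j = i
  · subst hj
    simp only [Function.update_self]
    cases b
    · simp only [Bool.false_eq_true, ↓reduceIte]
      have h : (fun z : ι → ℂ ↦ (⟨(z j).re, t⟩ : ℂ)) = fun z ↦ ((z j).re : ℂ) + (t : ℂ) * I :=
        funext fun z ↦ Complex.mk_eq_add_mul_I _ _
      rw [h]
      fun_prop
    · simp only [↓reduceIte]
      have h : (fun z : ι → ℂ ↦ (⟨t, (z j).im⟩ : ℂ)) = fun z ↦ (t : ℂ) + ((z j).im : ℂ) * I :=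
        funext fun z ↦ Complex.mk_eq_add_mul_I _ _
      rw [h]
      fun_prop
  · simp only [Function.update_of_ne hj]
    exact continuous_apply j

omit [Fintype ι] in
/-- If the coordinate `d` of `z` is already `t`, nothing changes. [folklore] -/
theorem setCoord_eq_self {d : ι × Bool} {t : ℝ} {z : ι → ℂ} (h : rc d z = t) : setCoord d t z = z := by
  obtain ⟨i, b⟩ := d
  unfold setCoord
  rw [Function.update_eq_iff]
  refine ⟨?_, fun j _ ↦ rfl⟩
  cases b
  · simp only [rc, Bool.false_eq_true, ↓reduceIte] at h
    simp only [Bool.false_eq_true, ↓reduceIte]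
    apply Complex.ext <;> simp [h]
  · simp only [rc, ↓reduceIte] at h
    simp only [↓reduceIte]
    apply Complex.ext <;> simp [h]

namespace ContCocycle

/-- **The continuous attaching step**: continuous frames on open neighbourhoods of
`A = K ∩ {y_d ≤ t}` and `B = K ∩ {y_d ≥ t}` (`K = [l, u]` a compact box) give a continuous frame on
an open neighbourhood of `K`: `F = F^A` on `{y_d ≤ t}`, `F = F^B (c ∘ π)⁻¹` on `{y_d ≥ t}` with
`c = (F^A)⁻¹ F^B` the transition function and `π` the projection onto `{y_d = t}` (the topological
shadow of Cartan's lemma: no splitting is needed). [folklore] -/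
theorem exists_cframe_glue_step (𝓖 : ContCocycle ι 𝔄 α) (d : ι × Bool) {l u : ι × Bool → ℝ}
    {t : ℝ} (hlt : l d ≤ t) (htu : t ≤ u d) {WA WB : Set (ι → ℂ)}
    (hA : IsOpen WA) (hB : IsOpen WB) (hAW : CBox l (Function.update u d t) ⊆ WA)
    (hBW : CBox (Function.update l d t) u ⊆ WB) (ΦA : 𝓖.CFrame WA) (ΦB : 𝓖.CFrame WB) :
    ∃ W : Set (ι → ℂ), IsOpen W ∧ CBox l u ⊆ W ∧ Nonempty (𝓖.CFrame W) := by
  classical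
  set π : (ι → ℂ) → (ι → ℂ) := setCoord d t with hπ
  have hπc : Continuous π := continuous_setCoord d t
  set c := CFrame.transFun ΦA ΦB with hc
  have hcc : ContinuousOn c (WA ∩ WB) := CFrame.continuousOn_transFun ΦA ΦB hA hB
  have hcu : ∀ z ∈ WA ∩ WB, IsUnit (c z) := fun z hz ↦ CFrame.isUnit_transFun ΦA ΦB hz
  -- the slice `S = K ∩ {y_d = t}` lies in `WA ∩ WB`
  have hSA : CBox (Function.update l d t) (Function.update u d t) ⊆ WA := by
    refine (CBox_mono (fun e ↦ ?_) (fun e ↦ le_rfl)).trans hAW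
    by_cases he : e = d
    · subst he; simp [hlt]
    · rw [Function.update_of_ne he]
  have hSB : CBox (Function.update l d t) (Function.update u d t) ⊆ WB := by
    refine (CBox_mono (fun e ↦ le_rfl) (fun e ↦ ?_)).trans hBW
    by_cases he : e = d
    · subst he; simp [htu]
    · rw [Function.update_of_ne he]
  have hπS : ∀ z ∈ CBox l u, π z ∈ CBox (Function.update l d t) (Function.update u d t) := by
    intro z hz e
    by_cases he : e = d
    · subst he; simp only [hπ, rc_setCoord_self, Function.update_self]; exact ⟨le_rfl, le_rfl⟩
    · rw [hπ, rc_setCoord_of_ne he, Function.update_of_ne he, Function.update_of_ne he]; exact hz e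
  -- the open neighbourhood of `K`
  set N : Set (ι → ℂ) := WA ∩ WB ∩ π ⁻¹' (WA ∩ WB) with hN
  set W : Set (ι → ℂ) := (WA ∩ {z | rc d z < t}) ∪ (WB ∩ π ⁻¹' (WA ∩ WB) ∩ {z | t < rc d z}) ∪ N
    with hW
  have hNo : IsOpen N := (hA.inter hB).inter ((hA.inter hB).preimage hπc)
  have hWo : IsOpen W := by
    refine ((hA.inter (isOpen_lt (continuous_rc d) continuous_const)).union
      ((hB.inter ((hA.inter hB).preimage hπc)).inter
        (isOpen_lt continuous_const (continuous_rc d)))).union hNo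
  have hW1 : ∀ z ∈ W, rc d z ≤ t → z ∈ WA := by
    rintro z ((⟨hzA, -⟩ | ⟨-, hzt⟩) | hzN) hle
    · exact hzA
    · exact absurd hle (not_le.2 hzt)
    · exact hzN.1.1
  have hW2 : ∀ z ∈ W, t ≤ rc d z → z ∈ WB ∧ π z ∈ WA ∩ WB := by
    rintro z ((⟨-, hzt⟩ | ⟨⟨hzB, hzπ⟩, -⟩) | hzN) hle
    · exact absurd hle (not_le.2 hzt)
    · exact ⟨hzB, hzπ⟩
    · exact ⟨hzN.1.2, hzN.2⟩
  -- the glued frame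
  set F : α → (ι → ℂ) → 𝔄 := fun a z ↦
    if rc d z ≤ t then ΦA.F a z else ΦB.F a z * Ring.inverse (c (π z)) with hF
  have hagree : ∀ a, ∀ z ∈ W ∩ 𝓖.U a, rc d z = t →
      ΦA.F a z = ΦB.F a z * Ring.inverse (c (π z)) := by
    intro a z hz hzt
    have hzAB : z ∈ WA ∩ WB := ⟨hW1 z hz.1 hzt.le, (hW2 z hz.1 hzt.ge).1⟩
    rw [show π z = z from setCoord_eq_self hzt, CFrame.F_eq_F_mul_transFun ΦA ΦB ⟨hzAB, hz.2⟩,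
      ← hc, mul_assoc, Ring.mul_inverse_cancel _ (hcu z hzAB), mul_one]
  refine ⟨W, hWo, ?_, ⟨{ F := F, continuousOn := ?_, isUnit := ?_, transition := ?_ }⟩⟩
  · -- `K ⊆ W`
    intro z hz
    rcases lt_trichotomy (rc d z) t with hlt' | heq | hgt
    · have hzA : z ∈ CBox l (Function.update u d t) := fun e ↦ by
        by_cases he : e = d
        · subst he; simpa using ⟨(hz e).1, hlt'.le⟩
        · rw [Function.update_of_ne he]; exact hz e
      exact Or.inl (Or.inl ⟨hAW hzA, hlt'⟩)
    · have hzS : z ∈ CBox (Function.update l d t) (Function.update u d t) := fun e ↦ by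
        by_cases he : e = d
        · subst he; simpa using ⟨heq.ge, heq.le⟩
        · rw [Function.update_of_ne he, Function.update_of_ne he]; exact hz e
      refine Or.inr ⟨⟨hSA hzS, hSB hzS⟩, ?_⟩
      show π z ∈ WA ∩ WB
      rw [show π z = z from setCoord_eq_self heq]
      exact ⟨hSA hzS, hSB hzS⟩
    · have hzB : z ∈ CBox (Function.update l d t) u := fun e ↦ by
        by_cases he : e = d
        · subst he; simpa using ⟨hgt.le, (hz e).2⟩
        · rw [Function.update_of_ne he]; exact hz e
      exact Or.inl (Or.inr ⟨⟨hBW hzB, ⟨hSA (hπS z hz), hSB (hπS z hz)⟩⟩, hgt⟩)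
  · -- continuity: pasting along the hyperplane
    intro a
    refine ContinuousOn.if ?_ ?_ ?_
    · rintro z ⟨hz, hzfr⟩
      have hzt : rc d z = t := frontier_le_subset_eq (continuous_rc d) continuous_const hzfr
      exact hagree a z hz hzt
    · have hcl : closure {z : ι → ℂ | rc d z ≤ t} = {z | rc d z ≤ t} :=
        (isClosed_le (continuous_rc d) continuous_const).closure_eq
      rw [hcl]
      exact (ΦA.continuousOn a).mono fun z hz ↦ ⟨hW1 z hz.1.1 hz.2, hz.1.2⟩
    · have hcl : closure {z : ι → ℂ | ¬rc d z ≤ t} ⊆ {z | t ≤ rc d z} := by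
        have : {z : ι → ℂ | ¬rc d z ≤ t} = {z | t < rc d z} := by ext z; simp [not_le]
        rw [this]
        exact closure_lt_subset_le continuous_const (continuous_rc d)
      have hsub : W ∩ 𝓖.U a ∩ closure {z : ι → ℂ | ¬rc d z ≤ t} ⊆
          {z | z ∈ WB ∧ π z ∈ WA ∩ WB} ∩ 𝓖.U a := fun z hz ↦
        ⟨hW2 z hz.1.1 (hcl hz.2), hz.1.2⟩
      refine ContinuousOn.mono ?_ hsub
      refine ((ΦB.continuousOn a).mono fun z hz ↦ ⟨hz.1.1, hz.2⟩).mul ?_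
      refine continuousOn_ringInverse_comp ?_ fun z hz ↦ hcu _ hz.1.2
      exact hcc.comp hπc.continuousOn fun z hz ↦ hz.1.2
  · -- invertible values
    rintro a z ⟨hz, hza⟩
    by_cases hzt : rc d z ≤ t
    · simp only [hF, hzt, ↓reduceIte]
      exact ΦA.isUnit a z ⟨hW1 z hz hzt, hza⟩
    · simp only [hF, hzt, ↓reduceIte]
      obtain ⟨hzB, hzπ⟩ := hW2 z hz (not_le.1 hzt).le
      exact (ΦB.isUnit a z ⟨hzB, hza⟩).mul (hcu _ hzπ).ringInverse
  · -- the transition rule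
    rintro a b z ⟨⟨hz, hza⟩, hzb⟩
    by_cases hzt : rc d z ≤ t
    · simp only [hF, hzt, ↓reduceIte]
      exact ΦA.transition a b z ⟨⟨hW1 z hz hzt, hza⟩, hzb⟩
    · simp only [hF, hzt, ↓reduceIte]
      obtain ⟨hzB, -⟩ := hW2 z hz (not_le.1 hzt).le
      rw [ΦB.transition a b z ⟨⟨hzB, hza⟩, hzb⟩, mul_assoc]

end ContCocycle

end Step

section CubeHelper

variable {ι : Type*}

/-- Corners all of whose sides are points describe a single point (as
`CBox_subset_singleton_of_forall_eq` in `HolomorphicCocyclesAffine.lean`). [folklore] -/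
theorem CBox_subset_singleton_of_forall_eq' {l u : ι × Bool → ℝ} (h : ∀ e, l e = u e) :
    CBox l u ⊆ {fun i ↦ (⟨l (i, true), l (i, false)⟩ : ℂ)} := by
  intro z hz
  rw [mem_singleton_iff]
  funext i
  apply Complex.ext
  · have h1 := hz (i, true); rw [← h (i, true)] at h1; simpa using le_antisymm h1.2 h1.1
  · have h1 := hz (i, false); rw [← h (i, false)] at h1; simpa using le_antisymm h1.2 h1.1

end CubeHelper

/-! ### The cube induction (as in Leiterer, Lemma 5.2.1) -/

section Cubes

variable {ι : Type*} [Fintype ι] [DecidableEq ι] {𝔄 : Type*} [NormedRing 𝔄] [CompleteSpace 𝔄]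
  {α : Type*}

namespace ContCocycle

open Classical in
/-- **Every compact box has a continuous frame neighbourhood.** For every compact box
`K = [l, u] ⊆ ℂ^ι` (degenerate sides allowed) a continuous cocycle on `ℂ^ι` admits a continuous
frame over some open neighbourhood of `K`: induction on the number of non-degenerate sides exactly
as in `HolCocycle.exists_frame_nhds_CBox` (slices, uniform box neighbourhoods, a Lebesgue number,
attaching slab after slab by `exists_cframe_glue_step`). [folklore] -/
theorem exists_cframe_nhds_CBox (𝓖 : ContCocycle ι 𝔄 α) (l u : ι × Bool → ℝ)
    (hlu : ∀ e, l e ≤ u e) :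
    ∃ W : Set (ι → ℂ), IsOpen W ∧ CBox l u ⊆ W ∧ Nonempty (𝓖.CFrame W) := by
  suffices H : ∀ (n : ℕ) (l u : ι × Bool → ℝ), (∀ e, l e ≤ u e) →
      (Finset.univ.filter fun e ↦ l e < u e).card ≤ n →
      ∃ W : Set (ι → ℂ), IsOpen W ∧ CBox l u ⊆ W ∧ Nonempty (𝓖.CFrame W) from
    H _ l u hlu le_rfl
  intro n
  induction n with
  | zero =>
    intro l u hlu hcard
    have heq : ∀ e, l e = u e := fun e ↦ by
      have h0 : e ∉ Finset.univ.filter fun e ↦ l e < u e := by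
        rw [Finset.card_eq_zero.1 (Nat.le_zero.1 hcard)]; simp
      simp only [Finset.mem_filter, Finset.mem_univ, true_and, not_lt] at h0
      exact le_antisymm (hlu e) h0
    set pt : ι → ℂ := fun i ↦ ⟨l (i, true), l (i, false)⟩
    obtain ⟨a₀, ha₀⟩ := 𝓖.exists_mem pt
    refine ⟨𝓖.U a₀, 𝓖.isOpen_U a₀, fun z hz ↦ ?_, ⟨CFrame.ofChart 𝓖 a₀⟩⟩
    rw [mem_singleton_iff.1 (CBox_subset_singleton_of_forall_eq' heq hz)]
    exact ha₀
  | succ n ih =>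
    intro l u hlu hcard
    by_cases hn : (Finset.univ.filter fun e ↦ l e < u e).card ≤ n
    · exact ih l u hlu hn
    have hne : (Finset.univ.filter fun e ↦ l e < u e).Nonempty := by
      rw [← Finset.card_pos]; omega
    obtain ⟨d, hd⟩ := hne
    simp only [Finset.mem_filter, Finset.mem_univ, true_and] at hd
    have hslice : ∀ s ∈ Icc (l d) (u d), ∃ ε > (0 : ℝ), ∃ W : Set (ι → ℂ), IsOpen W ∧
        Nonempty (𝓖.CFrame W) ∧
        OBox (fun e ↦ Function.update l d s e - ε) (fun e ↦ Function.update u d s e + ε) ⊆ W := by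
      intro s hs
      have hlu' : ∀ e, Function.update l d s e ≤ Function.update u d s e := fun e ↦ by
        by_cases he : e = d
        · subst he; simp
        · rw [Function.update_of_ne he, Function.update_of_ne he]; exact hlu e
      have hcard' : (Finset.univ.filter fun e ↦
          Function.update l d s e < Function.update u d s e).card ≤ n := by
        have hsub : (Finset.univ.filter fun e ↦ Function.update l d s e < Function.update u d s e) ⊂
            Finset.univ.filter fun e ↦ l e < u e := by
          rw [Finset.ssubset_iff_of_subset]
          · refine ⟨d, by simpa using hd, ?_⟩
            simp
          · intro e he
            simp only [Finset.mem_filter, Finset.mem_univ, true_and] at he ⊢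
            by_cases hed : e = d
            · subst hed; simp at he
            · rwa [Function.update_of_ne hed, Function.update_of_ne hed] at he
        have := Finset.card_lt_card hsub
        omega
      obtain ⟨W, hW, hKW, hΦ⟩ := ih _ _ hlu' hcard'
      obtain ⟨ε, hε, hεW⟩ := exists_OBox_subset_of_isOpen hlu' hW hKW
      exact ⟨ε, hε, W, hW, hΦ, hεW⟩
    choose! ε hε W hW hΦ hεW using hslice
    obtain ⟨δ, hδ, hleb⟩ := lebesgue_number_lemma_of_metric (ι := Icc (l d) (u d))
      (c := fun s ↦ ball (s : ℝ) (ε s / 2)) isCompact_Icc (fun _ ↦ isOpen_ball)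
      (fun x hx ↦ mem_iUnion.2 ⟨⟨x, hx⟩, mem_ball_self (half_pos (hε x hx))⟩)
    obtain ⟨m, hm⟩ := exists_nat_gt ((u d - l d) / δ)
    have hm0 : (0 : ℝ) < m := lt_trans (div_pos (sub_pos.2 hd) hδ) hm
    have hmpos : 0 < m := by exact_mod_cast hm0
    set w : ℝ := (u d - l d) / m with hw
    have hw0 : 0 < w := div_pos (sub_pos.2 hd) hm0
    have hwδ : w < δ := by
      rw [hw, div_lt_iff₀ hm0]
      calc u d - l d = (u d - l d) / δ * δ := by field_simp
        _ < m * δ := by gcongr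
        _ = δ * m := mul_comm _ _
    set tk : ℕ → ℝ := fun k ↦ l d + k * w with htk
    have htk0 : tk 0 = l d := by simp [htk]
    have htkm : tk m = u d := by
      simp only [htk, hw]; field_simp; ring
    have htk_succ : ∀ k, tk (k + 1) = tk k + w := fun k ↦ by simp only [htk]; push_cast; ring
    have htk_mono : ∀ k, tk k ≤ tk (k + 1) := fun k ↦ by rw [htk_succ]; linarith
    have htk_ge : ∀ k, l d ≤ tk k := fun k ↦ by
      simp only [htk]; nlinarith [hw0.le, (Nat.cast_nonneg k : (0 : ℝ) ≤ k)]
    have htk_le : ∀ k, k ≤ m → tk k ≤ u d := fun k hk ↦ by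
      rw [← htkm]; simp only [htk]
      have : (k : ℝ) ≤ m := by exact_mod_cast hk
      nlinarith [hw0.le]
    have hslab : ∀ k, k < m → ∃ W' : Set (ι → ℂ), IsOpen W' ∧
        CBox (Function.update l d (tk k)) (Function.update u d (tk (k + 1))) ⊆ W' ∧
        Nonempty (𝓖.CFrame W') := by
      intro k hk
      have hx : tk k ∈ Icc (l d) (u d) := ⟨htk_ge k, htk_le k hk.le⟩
      obtain ⟨⟨s, hs⟩, hball⟩ := hleb (tk k) hx
      refine ⟨W s, hW s hs, fun z hz ↦ hεW s hs fun e ↦ ?_, hΦ s hs⟩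
      dsimp only
      by_cases he : e = d
      · subst he
        simp only [Function.update_self]
        have hzd := hz e
        simp only [Function.update_self] at hzd
        have hmem : rc e z ∈ ball s (ε s / 2) := by
          refine hball ?_
          rw [mem_ball, Real.dist_eq, abs_sub_lt_iff]
          constructor <;> linarith [hzd.1, hzd.2, htk_succ k]
        rw [mem_ball, Real.dist_eq, abs_sub_lt_iff] at hmem
        have := hε s hs
        constructor <;> linarith [hmem.1, hmem.2]
      · rw [Function.update_of_ne he, Function.update_of_ne he]
        have hzd := hz e
        rw [Function.update_of_ne he, Function.update_of_ne he] at hzd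
        have := hε s hs
        constructor <;> linarith [hzd.1, hzd.2]
    have hunion : ∀ k, 1 ≤ k → k ≤ m → ∃ W' : Set (ι → ℂ), IsOpen W' ∧
        CBox l (Function.update u d (tk k)) ⊆ W' ∧ Nonempty (𝓖.CFrame W') := by
      intro k
      induction k with
      | zero => intro h; omega
      | succ k ihk =>
        intro _ hkm
        by_cases hk0 : k = 0
        · subst hk0
          obtain ⟨W', h1, h2, h3⟩ := hslab 0 (by omega)
          refine ⟨W', h1, ?_, h3⟩
          rwa [htk0, Function.update_eq_self] at h2
        obtain ⟨WA, hA, hAK, ⟨ΦA⟩⟩ := ihk (by omega) (by omega)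
        obtain ⟨WB, hB, hBK, ⟨ΦB⟩⟩ := hslab k (by omega)
        exact exists_cframe_glue_step 𝓖 d (t := tk k) (htk_ge k) (by simpa using htk_mono k)
          hA hB (by rwa [Function.update_idem]) hBK ΦA ΦB
    obtain ⟨W', h1, h2, h3⟩ := hunion m hmpos le_rfl
    refine ⟨W', h1, ?_, h3⟩
    rwa [htkm, Function.update_eq_self] at h2

end ContCocycle

end Cubes

/-! ### Exhaustion of `ℂ^ι` by cubes: the frames are made to agree and stabilise -/

section Exhaustion

variable {ι : Type*} [Fintype ι] [DecidableEq ι] {𝔄 : Type*} [NormedRing 𝔄] [CompleteSpace 𝔄]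
  {α : Type*}

omit [Fintype ι] [DecidableEq ι] in
/-- Clamping into a box is continuous. [folklore] -/
theorem continuous_clampBox (l u : ι × Bool → ℝ) : Continuous (clampBox l u) := by
  refine continuous_pi fun i ↦ ?_
  have h : (fun z : ι → ℂ ↦ clampBox l u z i) = fun z ↦
      ((max (l (i, true)) (min (z i).re (u (i, true))) : ℝ) : ℂ) +
        ((max (l (i, false)) (min (z i).im (u (i, false))) : ℝ) : ℂ) * I :=
    funext fun z ↦ Complex.mk_eq_add_mul_I _ _
  rw [h]
  fun_prop

omit [Fintype ι] [DecidableEq ι] in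
/-- Clamping fixes the points of the box. [folklore] -/
theorem clampBox_eq_self {l u : ι × Bool → ℝ} {z : ι → ℂ} (hz : z ∈ CBox l u) :
    clampBox l u z = z := by
  funext i
  have h1 := hz (i, true)
  have h2 := hz (i, false)
  simp only [rc_true, rc_false] at h1 h2
  apply Complex.ext
  · show max (l (i, true)) (min (z i).re (u (i, true))) = (z i).re
    rw [min_eq_left h1.2, max_eq_right h1.1]
  · show max (l (i, false)) (min (z i).im (u (i, false))) = (z i).im
    rw [min_eq_left h2.2, max_eq_right h2.1]

namespace ContCocycle

/-- **A stage of the exhaustion**: an open neighbourhood of the cube `K_m = [−(m+1), m+1]^{2ι}` with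
a continuous frame of the cocycle over it. [folklore] -/
structure CStage (𝓖 : ContCocycle ι 𝔄 α) (m : ℕ) where
  /-- The open set carrying the frame. -/
  W : Set (ι → ℂ)
  /-- `W` is open. -/
  isOpen : IsOpen W
  /-- `W` contains the cube `K_m`. -/
  cube_subset : CBox (fun _ ↦ -((m : ℝ) + 1)) (fun _ ↦ (m : ℝ) + 1) ⊆ W
  /-- The frame. -/
  Φ : 𝓖.CFrame W

/-- Stages exist (the cube induction). [folklore] -/
theorem nonempty_cstage (𝓖 : ContCocycle ι 𝔄 α) (m : ℕ) : Nonempty (𝓖.CStage m) := by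
  obtain ⟨W, hW, hKW, ⟨Φ⟩⟩ := exists_cframe_nhds_CBox 𝓖 (fun _ ↦ -((m : ℝ) + 1))
    (fun _ ↦ (m : ℝ) + 1) (fun _ ↦ by linarith)
  exact ⟨⟨W, hW, hKW, Φ⟩⟩

/-- **The next stage, agreeing with the given one on the open cube.** A frame near `K_{m+1}` is
corrected by the continuous invertible map `(c ∘ clampBox_{K_m})⁻¹`, `c` the transition function from
the given frame near `K_m`, so that the two frames AGREE on `K_m` (no approximation is needed in the
continuous category). [folklore] -/
def nextCStage (𝓖 : ContCocycle ι 𝔄 α) (m : ℕ) (s : 𝓖.CStage m) : 𝓖.CStage (m + 1) :=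
  let s' : 𝓖.CStage (m + 1) := (nonempty_cstage 𝓖 (m + 1)).some
  let κ : (ι → ℂ) → (ι → ℂ) := clampBox (fun _ ↦ -((m : ℝ) + 1)) (fun _ ↦ (m : ℝ) + 1)
  let c : (ι → ℂ) → 𝔄 := CFrame.transFun s.Φ s'.Φ
  have hκ : ∀ z, κ z ∈ s.W ∩ s'.W := fun z ↦ by
    have hmem := clampBox_mem (l := fun _ : ι × Bool ↦ -((m : ℝ) + 1)) (u := fun _ ↦ (m : ℝ) + 1)
      (fun _ ↦ by linarith) z
    refine ⟨s.cube_subset hmem, s'.cube_subset (CBox_mono (fun _ ↦ ?_) (fun _ ↦ ?_) hmem)⟩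
    · push_cast; linarith
    · push_cast; linarith
  have hcont : Continuous fun z ↦ Ring.inverse (c (κ z)) := by
    rw [← continuousOn_univ]
    refine continuousOn_ringInverse_comp ?_ fun z _ ↦ CFrame.isUnit_transFun _ _ (hκ z)
    exact (CFrame.continuousOn_transFun s.Φ s'.Φ s.isOpen s'.isOpen).comp
      (continuous_clampBox _ _).continuousOn fun z _ ↦ hκ z
  { W := s'.W
    isOpen := s'.isOpen
    cube_subset := s'.cube_subset
    Φ := s'.Φ.mulRight (fun z ↦ Ring.inverse (c (κ z))) hcont.continuousOn
      fun z _ ↦ (CFrame.isUnit_transFun _ _ (hκ z)).ringInverse }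

/-- The next stage agrees with the given one on the cube `K_m`. [folklore] -/
theorem nextCStage_F_eq (𝓖 : ContCocycle ι 𝔄 α) (m : ℕ) (s : 𝓖.CStage m) (a : α) {z : ι → ℂ}
    (hz : z ∈ CBox (fun _ ↦ -((m : ℝ) + 1)) (fun _ ↦ (m : ℝ) + 1)) (hza : z ∈ 𝓖.U a) :
    (nextCStage 𝓖 m s).Φ.F a z = s.Φ.F a z := by
  have hz' : z ∈ (nonempty_cstage 𝓖 (m + 1)).some.W :=
    (nonempty_cstage 𝓖 (m + 1)).some.cube_subset (CBox_mono (fun _ ↦ by push_cast; linarith)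
      (fun _ ↦ by push_cast; linarith) hz)
  simp only [nextCStage, CFrame.mulRight_F, clampBox_eq_self hz]
  rw [CFrame.F_eq_F_mul_transFun s.Φ _ ⟨⟨s.cube_subset hz, hz'⟩, hza⟩, mul_assoc,
    Ring.mul_inverse_cancel _ (CFrame.isUnit_transFun _ _ ⟨s.cube_subset hz, hz'⟩), mul_one]

/-- The sequence of stages: start anywhere, then correct stage after stage. [folklore] -/
def cstageSeq (𝓖 : ContCocycle ι 𝔄 α) : (m : ℕ) → 𝓖.CStage m
  | 0 => (nonempty_cstage 𝓖 0).some
  | m + 1 => nextCStage 𝓖 m (cstageSeq 𝓖 m)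

/-- The frames of the sequence agree on the cubes: `F^{(n)} = F^{(m)}` on `K_m` for `m ≤ n`.
[folklore] -/
theorem cstageSeq_F_eq (𝓖 : ContCocycle ι 𝔄 α) {m n : ℕ} (hmn : m ≤ n) (a : α) {z : ι → ℂ}
    (hz : z ∈ CBox (fun _ ↦ -((m : ℝ) + 1)) (fun _ ↦ (m : ℝ) + 1)) (hza : z ∈ 𝓖.U a) :
    (cstageSeq 𝓖 n).Φ.F a z = (cstageSeq 𝓖 m).Φ.F a z := by
  induction hmn with
  | refl => rfl
  | @step n hmn ih =>
    have hzn : z ∈ CBox (fun _ ↦ -((n : ℝ) + 1)) (fun _ ↦ (n : ℝ) + 1) := by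
      have h : (m : ℝ) ≤ n := by exact_mod_cast hmn
      exact CBox_mono (fun _ ↦ by linarith) (fun _ ↦ by linarith) hz
    rw [← ih]
    exact nextCStage_F_eq 𝓖 n (cstageSeq 𝓖 n) a hzn hza

omit [DecidableEq ι] in
/-- Every point lies in the open cube of index `⌈‖z‖⌉`. [folklore] -/
theorem mem_OBox_ceil_norm (z : ι → ℂ) :
    z ∈ OBox (fun _ ↦ -((⌈‖z‖⌉₊ : ℝ) + 1)) (fun _ ↦ (⌈‖z‖⌉₊ : ℝ) + 1) := fun d ↦ by
  have h1 : |rc d z| ≤ ‖z‖ := by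
    have h := abs_rc_sub_rc_le d z 0
    have h0 : rc d (0 : ι → ℂ) = 0 := by obtain ⟨i, b⟩ := d; cases b <;> simp
    simpa [h0] using h
  have h2 : ‖z‖ ≤ (⌈‖z‖⌉₊ : ℝ) := Nat.le_ceil _
  rw [abs_le] at h1
  constructor <;> linarith [h1.1, h1.2]

/-- **Continuous cocycles on `ℂⁿ` are continuously trivial** (topological `𝔄ˣ`-bundles over `ℂⁿ`
are trivial): every continuous multiplicative `1`-cocycle on `ℂ^ι` (`ι` finite) with values in the
units of a complete normed ring `𝔄` has a global continuous frame `F_a : U_a → 𝔄ˣ`,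
`F_a = g_{ab} F_b` on `U_a ∩ U_b`. (Steenrod §11: bundles over contractible bases; here by the cube
induction and an exhaustion by cubes on which the frames stabilise.) [folklore] -/
theorem exists_cframe_univ (𝓖 : ContCocycle ι 𝔄 α) : Nonempty (𝓖.CFrame univ) := by
  classical
  set N : (ι → ℂ) → ℕ := fun z ↦ ⌈‖z‖⌉₊ with hN
  set F : α → (ι → ℂ) → 𝔄 := fun a z ↦ (cstageSeq 𝓖 (N z)).Φ.F a z with hF
  -- on the open cube of index `M` the global maps are the maps of stage `M`
  have hFM : ∀ (M : ℕ) (a : α), ∀ z ∈ OBox (fun _ ↦ -((M : ℝ) + 1)) (fun _ ↦ (M : ℝ) + 1),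
      z ∈ 𝓖.U a → F a z = (cstageSeq 𝓖 M).Φ.F a z := by
    intro M a z hz hza
    simp only [hF]
    rcases le_total (N z) M with h | h
    · exact (cstageSeq_F_eq 𝓖 h a (OBox_subset_CBox _ _ (mem_OBox_ceil_norm z)) hza).symm
    · exact cstageSeq_F_eq 𝓖 h a (OBox_subset_CBox _ _ hz) hza
  have hKW : ∀ M : ℕ, OBox (fun _ ↦ -((M : ℝ) + 1)) (fun _ ↦ (M : ℝ) + 1) ⊆ (cstageSeq 𝓖 M).W :=
    fun M ↦ (OBox_subset_CBox _ _).trans (cstageSeq 𝓖 M).cube_subset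
  refine ⟨{ F := F, continuousOn := ?_, isUnit := ?_, transition := ?_ }⟩
  · intro a z hz
    set M := N z
    have hzM := mem_OBox_ceil_norm z
    have hopen : IsOpen (OBox (fun _ : ι × Bool ↦ -((M : ℝ) + 1)) (fun _ ↦ (M : ℝ) + 1) ∩ 𝓖.U a) :=
      (isOpen_OBox _ _).inter (𝓖.isOpen_U a)
    have hmem : z ∈ OBox (fun _ : ι × Bool ↦ -((M : ℝ) + 1)) (fun _ ↦ (M : ℝ) + 1) ∩ 𝓖.U a :=
      ⟨hzM, hz.2⟩
    have hc : ContinuousAt ((cstageSeq 𝓖 M).Φ.F a) z :=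
      (((cstageSeq 𝓖 M).Φ.continuousOn a).mono fun w hw ↦ ⟨hKW M hw.1, hw.2⟩).continuousAt
        (hopen.mem_nhds hmem)
    refine (hc.congr_of_eventuallyEq ?_).continuousWithinAt
    exact Filter.eventuallyEq_of_mem (hopen.mem_nhds hmem) fun w hw ↦ hFM M a w hw.1 hw.2
  · rintro a z ⟨-, hza⟩
    rw [hFM (N z) a z (mem_OBox_ceil_norm z) hza]
    exact (cstageSeq 𝓖 (N z)).Φ.isUnit a z ⟨hKW _ (mem_OBox_ceil_norm z), hza⟩
  · rintro a b z ⟨⟨-, hza⟩, hzb⟩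
    rw [hFM (N z) a z (mem_OBox_ceil_norm z) hza, hFM (N z) b z (mem_OBox_ceil_norm z) hzb]
    exact (cstageSeq 𝓖 (N z)).Φ.transition a b z ⟨⟨hKW _ (mem_OBox_ceil_norm z), hza⟩, hzb⟩

/-- **Continuous cocycles on `ℂⁿ` are continuous coboundaries**: in the notation of Leiterer,
Thm. 3.2 (ii), for `f ∈ Z¹(𝒰, 𝒞^{GL})` on `ℂ^ι` there is `c ∈ C⁰(𝒰, 𝒞^{GL})` with `c □ f = 1`
(which is holomorphic). Unbundled form of `exists_cframe_univ`. [folklore] -/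
theorem exists_continuous_coboundary (𝓖 : ContCocycle ι 𝔄 α) :
    ∃ F : α → (ι → ℂ) → 𝔄, (∀ a, ContinuousOn (F a) (𝓖.U a)) ∧
      (∀ a, ∀ z ∈ 𝓖.U a, IsUnit (F a z)) ∧
      ∀ a b, ∀ z ∈ 𝓖.U a ∩ 𝓖.U b, 𝓖.g a b z = F a z * Ring.inverse (F b z) := by
  obtain ⟨Φ⟩ := exists_cframe_univ 𝓖
  refine ⟨Φ.F, fun a ↦ (Φ.continuousOn a).mono fun z hz ↦ ⟨mem_univ _, hz⟩,
    fun a z hz ↦ Φ.isUnit a z ⟨mem_univ _, hz⟩, fun a b z hz ↦ ?_⟩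
  rw [Φ.transition a b z ⟨⟨mem_univ _, hz.1⟩, hz.2⟩, mul_assoc,
    Ring.mul_inverse_cancel _ (Φ.isUnit b z ⟨mem_univ _, hz.2⟩), mul_one]

end ContCocycle

end Exhaustion

end Literature.Analysis.Complex
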